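import Mathlib
import HarnessLib
import Summits.AtomisticToContinuum.BoseEinsteinCondensation.Theses.BECConjugateDomination
import Literature.MathematicalPhysics.QuantumManyBody.PeriodicBoseGas
import Literature.MathematicalPhysics.QuantumManyBody.PeriodicBoseGasFourier

/-!
# Sketch — crux-ideate stmt-AtomisticToContinuum-11785 (PuffFloor), ideator 1, round 1

First lemmas of two idea cards, typed over existing declarations (nothing proved here).

* Card `pair-subsolution-removal-energy`: `PairSubsolution`, `RemovalEnergyBound`,
  `MesoscopicPairCount`, `PairDensityBound`, and the glue shape `PairDensityBound → PuffFloor`.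
* Card `sacrificial-edge-layer`: `EdgeLayerStability`, `PairMomentBound`.
-/

namespace Summit.AtomisticToContinuum.BoseEinsteinCondensation.Cruxes.PuffFloor.Sketch

open scoped BigOperators Topology InnerProductSpace ENNReal
open Filter MeasureTheory

/-- The smooth class of the route (hypotheses of `PuffFloor`), bundled. -/
def SmoothClass (v : ℝ → ℝ≥0∞) : Prop :=
  open Literature.MathematicalPhysics.QuantumManyBody.BoseGas in
  IsRepulsiveFiniteRange v ∧ (∀ r, v r ≠ ⊤) ∧ ContDiff ℝ 2 (fun x : Space => (v ‖x‖).toReal) ∧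
    ∃ Cₑ : ℝ, ∀ x : Space, ‖iteratedFDeriv ℝ 2 (fun x : Space => (v ‖x‖).toReal) x‖ ≤
      Cₑ * Real.sqrt ((v ‖x‖).toReal)

/-- **Card A, first lemma (the lever).** The translation-averaged pair density
`G(r) = ∫_{cell^{n+1}} |Ψ(x₂ + r, x₂, x₃, …)|²` of a positive periodic minimiser of `N = n + 2`
bosons is, after a square root, a (very weak) SUBSOLUTION of the two-body operator
`-2Δ + v^per - μ₂` on `ℝ³`, where `μ₂ = E₀(n+2, L) - E₀(n, L)` is the two-particle removal energy:
for every non-negative compactly supported `C²` test function `φ`,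
`∫ √G · (-2 Δφ + (v^per - μ₂) φ) ≤ 0`.
(Proof sketch: integrate `Ψ · HΨ = E₀ Ψ²` over the other `n` particles, integrate by parts on the
torus, bound the `n`-body part below by `E₀(n, L) ρ₂` — the slice is an admissible periodic bosonic
trial state — drop the cross interactions `≥ 0`, and use `|∇√G|² ≤ ∫|∇₁√ρ₂|²`.) -/
def PairSubsolution : Prop :=
  open Literature.MathematicalPhysics.QuantumManyBody.BoseGas in
  ∀ v : ℝ → ℝ≥0∞, SmoothClass v → ∀ (n : ℕ) (L : ℝ), 0 < L →
    ∀ Ψ : PeriodicTrialState (n + 2) L,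
      periodicEnergy v Ψ = periodicGroundStateEnergy v (n + 2) L → periodicEnergy v Ψ ≠ ⊤ →
      ContDiff ℝ 3 Ψ.ψ → (∀ X, Ψ.ψ X = (‖Ψ.ψ X‖ : ℂ)) → (∀ X, Ψ.ψ X ≠ 0) →
      let G : Space → ℝ := fun r => ∫ X in cellN (n + 1) L, ‖Ψ.ψ (Matrix.vecCons (X 0 + r) X)‖ ^ 2
      let μ₂ : ℝ := (periodicGroundStateEnergy v (n + 2) L).toReal -
        (periodicGroundStateEnergy v n L).toReal
      ∀ φ : Space → ℝ, ContDiff ℝ 2 φ → HasCompactSupport φ → (∀ r, 0 ≤ φ r) →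
        ∫ r, Real.sqrt (G r) *
            (-2 * (Laplacian.laplacian φ : Space → ℝ) r + ((periodizedPotential v L r).toReal - μ₂) * φ r) ≤ 0

/-- **Card A, companion (cheap).** The two-particle removal energy is `O(ρ)`:
`E₀(n+2, L) ≤ E₀(n, L) + (2n+1) L⁻³ ∫_{ℝ³} v(|x|) dx` (trial state: the `n`-particle minimiser
times two constant one-particle factors; the absolute ground state is bosonic). -/
def RemovalEnergyBound : Prop :=
  open Literature.MathematicalPhysics.QuantumManyBody.BoseGas in
  ∀ v : ℝ → ℝ≥0∞, SmoothClass v → ∀ (n : ℕ) (L : ℝ), 0 < L →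
    (∃ R₀ : ℝ, (∀ r, R₀ < r → v r = 0) ∧ 2 * R₀ < L) →
    periodicGroundStateEnergy v (n + 2) L ≤ periodicGroundStateEnergy v n L +
      ENNReal.ofReal ((2 * n + 1) / L ^ 3 * ∫ x : Space, (v ‖x‖).toReal)

/-- **Card A, second crux-sized input.** No clustering at ONE mesoscopic scale: for the positive
minimiser, at some scale `R` with `R₀ ≤ R` and `ρ R² ≤ 1` (below the healing length), the expected
number of ordered pairs at torus distance `< 2R` is `≤ C ρ R³ N`. Intended proof: state-level cell
method (LSSY (2.52)) with cells of side `2R ≍ ℓ_LY`, plus a quadratic lower bound on the Neumann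
cell energies at all occupations (Temple box bound `LSSY2005_boxLowerBound`, LY at higher density,
superstability for dense cells — the last needs `v(0) > 0`). -/
def MesoscopicPairCount : Prop :=
  open Literature.MathematicalPhysics.QuantumManyBody.BoseGas in
  ∀ v : ℝ → ℝ≥0∞, SmoothClass v → ∃ C : ℝ, 0 ≤ C ∧ ∃ ρ₀ : ℝ, 0 < ρ₀ ∧ ∀ ρ : ℝ, 0 < ρ → ρ < ρ₀ →
    ∃ R : ℝ, (∀ r, R < r → v r = 0) ∧ 0 < R ∧ ρ * R ^ 2 ≤ 1 ∧
    ∀ᶠ n : ℕ in atTop, ∀ Ψ : PeriodicTrialState (n + 2) (sideLength ρ (n + 2)),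
      (let L : ℝ := sideLength ρ (n + 2)
       let near : Space → ℝ := fun x =>
         ∑' m : Fin 3 → ℤ, (Metric.ball (0 : Space) (2 * R)).indicator (fun _ => (1 : ℝ))
           (x - latticeVec L m)
       periodicEnergy v Ψ = periodicGroundStateEnergy v (n + 2) L → periodicEnergy v Ψ ≠ ⊤ →
       (∀ X, Ψ.ψ X = (‖Ψ.ψ X‖ : ℂ)) → (∀ X, Ψ.ψ X ≠ 0) →
       ∫ X in cellN (n + 2) L,
           (∑ i : Fin (n + 2), ∑ j : Fin (n + 2) with i ≠ j, near (X i - X j)) * ‖Ψ.ψ X‖ ^ 2 ≤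
         C * ρ * R ^ 3 * (n + 2))

/-- **Card A, the node PuffFloor needs.** Bounded bunching inside the range: the averaged pair
density of the positive minimiser is at most `C` times its uncorrelated value `L⁻³` at every
separation `r` with `|r| ≤ R₀` (indeed at every `|r| ≲ ρ^{-2/5}`). From `PairSubsolution`,
`RemovalEnergyBound`, the interior mean-value inequality for `-Δu ≤ λu`, and
`MesoscopicPairCount`. -/
def PairDensityBound : Prop :=
  open Literature.MathematicalPhysics.QuantumManyBody.BoseGas in
  ∀ v : ℝ → ℝ≥0∞, SmoothClass v → ∃ C : ℝ, 0 ≤ C ∧ ∃ ρ₀ : ℝ, 0 < ρ₀ ∧ ∀ ρ : ℝ, 0 < ρ → ρ < ρ₀ →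
    ∀ᶠ n : ℕ in atTop, ∀ Ψ : PeriodicTrialState (n + 2) (sideLength ρ (n + 2)),
      (let L : ℝ := sideLength ρ (n + 2)
       let G : Space → ℝ := fun r => ∫ X in cellN (n + 1) L, ‖Ψ.ψ (Matrix.vecCons (X 0 + r) X)‖ ^ 2
       periodicEnergy v Ψ = periodicGroundStateEnergy v (n + 2) L → periodicEnergy v Ψ ≠ ⊤ →
       (∀ X, Ψ.ψ X = (‖Ψ.ψ X‖ : ℂ)) → (∀ X, Ψ.ψ X ≠ 0) →
       ∀ r : Space, v ‖r‖ ≠ 0 → L ^ 3 * G r ≤ C)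

/-- **Interior mean-value inequality** (classical; the PDE support item of Card A): a non-negative
`C²` function on `ℝ³` with `-Δu ≤ λ u` on a ball, `λ R² ≤ 1`, is at most a universal constant
times its average over the ball. -/
def SubsolutionMeanValue : Prop :=
  ∃ C₀ : ℝ, ∀ (u : EuclideanSpace ℝ (Fin 3) → ℝ) (x₀ : EuclideanSpace ℝ (Fin 3)) (R lam : ℝ),
    0 < R → 0 ≤ lam → lam * R ^ 2 ≤ 1 → ContDiff ℝ 2 u → (∀ x, 0 ≤ u x) →
    (∀ x ∈ Metric.ball x₀ R, -(Laplacian.laplacian u : EuclideanSpace ℝ (Fin 3) → ℝ) x ≤ lam * u x) →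
    u x₀ ≤ C₀ * (volume (Metric.ball x₀ R)).toReal⁻¹ * ∫ x in Metric.ball x₀ R, u x

/-- Shape of the line: the Puff algebra (Hölder `m₁³ ≤ m₀² m₃`, f-sum rule, cubic moment) turns
the bounded-bunching node into the crux. Stated as an implication to be proved (support item). -/
def PuffFromPairDensity : Prop :=
  PairDensityBound →
    Summit.AtomisticToContinuum.BoseEinsteinCondensation.Theses.BECConjugateDomination.PuffFloor

/-- **Card B, first lemma (the lever's load-bearing input).** Dilute stability under a sacrificial
edge layer: with `w(x) = |x|² ‖D²ṽ(x)‖` (Puff's weight, periodised), there is `μ > 0` such that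
`H(v) - μ Σ_{i<j} w(xᵢ - xⱼ) ≥ -C ρ N` on the torus at density `ρ < ρ₀`, eventually in `N` —
stated on the quadratic form. (Why it might fail: false for hollow-core members; for
`v(0) > 0` it is a Yin-2010-type lower bound for a potential with a shallow thin negative layer.) -/
def EdgeLayerStability : Prop :=
  open Literature.MathematicalPhysics.QuantumManyBody.BoseGas in
  ∀ v : ℝ → ℝ≥0∞, SmoothClass v → 0 < v 0 →
    ∃ μ : ℝ, 0 < μ ∧ ∃ C : ℝ, 0 ≤ C ∧ ∃ ρ₀ : ℝ, 0 < ρ₀ ∧ ∀ ρ : ℝ, 0 < ρ → ρ < ρ₀ →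
    ∀ᶠ n : ℕ in atTop, ∀ Φ : PeriodicTrialState (n + 1) (sideLength ρ (n + 1)),
      (let L : ℝ := sideLength ρ (n + 1)
       let w : Space → ℝ := fun x =>
         ∑' m : Fin 3 → ℤ, ‖x - latticeVec L m‖ ^ 2 *
           ‖iteratedFDeriv ℝ 2 (fun y : Space => (v ‖y‖).toReal) (x - latticeVec L m)‖
       periodicEnergy v Φ ≠ ⊤ →
       μ * ∫ X in cellN (n + 1) L,
           (∑ i : Fin (n + 1), ∑ j : Fin (n + 1) with i < j, w (X i - X j)) * ‖Φ.ψ X‖ ^ 2 ≤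
         (periodicEnergy v Φ).toReal + C * ρ * (n + 1))

/-- **Card B, the node PuffFloor needs** (one-sided Hellmann–Feynman: apply `EdgeLayerStability` to
the minimiser `Ψ` of `H(v)` and use `E₀ ≤ ρ‖ṽ‖₁N/2`): Puff's pair moment is `O(ρ)` per particle. -/
def PairMomentBound : Prop :=
  open Literature.MathematicalPhysics.QuantumManyBody.BoseGas in
  ∀ v : ℝ → ℝ≥0∞, SmoothClass v → 0 < v 0 →
    ∃ C : ℝ, 0 ≤ C ∧ ∃ ρ₀ : ℝ, 0 < ρ₀ ∧ ∀ ρ : ℝ, 0 < ρ → ρ < ρ₀ →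
    ∀ᶠ n : ℕ in atTop, ∀ Ψ : PeriodicTrialState (n + 1) (sideLength ρ (n + 1)),
      (let L : ℝ := sideLength ρ (n + 1)
       let w : Space → ℝ := fun x =>
         ∑' m : Fin 3 → ℤ, ‖x - latticeVec L m‖ ^ 2 *
           ‖iteratedFDeriv ℝ 2 (fun y : Space => (v ‖y‖).toReal) (x - latticeVec L m)‖
       periodicEnergy v Ψ = periodicGroundStateEnergy v (n + 1) L → periodicEnergy v Ψ ≠ ⊤ →
       ∫ X in cellN (n + 1) L,
           (∑ i : Fin (n + 1), ∑ j : Fin (n + 1) with i < j, w (X i - X j)) * ‖Ψ.ψ X‖ ^ 2 ≤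
         C * ρ * (n + 1))

/-- Trivial direction recorded for the card: stability implies the pair-moment bound for the
minimiser is pure bookkeeping (stated, not proved here). -/
def PairMomentFromStability : Prop := EdgeLayerStability → PairMomentBound

end Summit.AtomisticToContinuum.BoseEinsteinCondensation.Cruxes.PuffFloor.Sketch
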